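import Mathlib
import Literature.AlgebraicGeometry.Resolution.RegularLocalRingsProofs
import HarnessLib

/-!
# Hypersurface quotient data of a regular local ring (crux `FrobeniusLadder.FRationalResolution`, line `Sketch`)

Stub `stub_hypersurface_quotient_data` of the skeleton `Sketch` for crux
stmt-ResolutionOfSingularities-15317. The line proves "F-rational ⇒ weakly F-regular" on the
Gorenstein sector for complete-intersection quotients `R = S/(G)` of a regular local ring `S` with
`G.length + dim R = dim S`; this file packages the HYPERSURFACE case `G = [g]`, `g ∈ 𝔪_S`, `g ≠ 0`:

* `S ⧸ (g)` is nontrivial, because `(g) ⊆ 𝔪_S` is a proper ideal;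
* the kernel of `S → S ⧸ (g)` is `(g) = Ideal.ofList [g]` (`Ideal.mk_ker`, `Ideal.ofList_singleton`);
* `dim (S ⧸ (g)) = d` is a natural number with `[g].length + d = 1 + d = dim S`: a regular local ring
  is a domain (Matsumura Thm. 14.3, the tree's `isDomain_of_isRegularLocalRing`), so `g ≠ 0` is a
  non-zero-divisor in the maximal ideal and the dimension drops by exactly one (Mathlib's
  `ringKrullDim_quotient_span_singleton_succ_eq_ringKrullDim_of_mem_nonZeroDivisors`).
-/

set_option linter.dupNamespace false

namespace Summit.ResolutionOfSingularities.ResolutionOfSingularities.Theorems.FRationalResolution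

open IsLocalRing

/-- **Hypersurface quotient data.** For a regular local ring `S` and `0 ≠ g ∈ 𝔪_S`: the quotient
`S ⧸ (g)` is nontrivial, the kernel of `S → S ⧸ (g)` is `Ideal.ofList [g]`, and
`dim (S ⧸ (g)) = d ∈ ℕ` with `[g].length + d = dim S` (a regular local ring is a domain, so `g` is a
non-zero-divisor and cutting by it drops the dimension by exactly one). This is the input of the
complete-intersection socle computation for hypersurface local rings. -/
theorem stub_hypersurface_quotient_data (S : Type) [CommRing S] [IsRegularLocalRing S] (g : S)
    (hg : g ∈ IsLocalRing.maximalIdeal S) (hg0 : g ≠ 0) :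
    Nontrivial (S ⧸ Ideal.span {g}) ∧
    RingHom.ker (Ideal.Quotient.mk (Ideal.span {g})) = Ideal.ofList [g] ∧
    ∃ d : ℕ, ringKrullDim (S ⧸ Ideal.span {g}) = d ∧
      ((([g].length + d : ℕ) : WithBot ℕ∞) = ringKrullDim S) := by
  -- `(g) ⊆ 𝔪_S` is proper, so the quotient is nontrivial
  have hne : Ideal.span {g} ≠ ⊤ :=
    Ideal.span_singleton_ne_top ((IsLocalRing.mem_maximalIdeal g).mp hg)
  haveI hnt : Nontrivial (S ⧸ Ideal.span {g}) := Ideal.Quotient.nontrivial_iff.mpr hne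
  -- a regular local ring is a domain, so `g ≠ 0` is a non-zero-divisor and `dim S/(g) + 1 = dim S`
  haveI : IsDomain S := Literature.AlgebraicGeometry.Resolution.isDomain_of_isRegularLocalRing S
  have hreg : g ∈ nonZeroDivisors S := mem_nonZeroDivisors_of_ne_zero hg0
  have hdim :=
    ringKrullDim_quotient_span_singleton_succ_eq_ringKrullDim_of_mem_nonZeroDivisors hreg hg
  -- the quotient is again a Noetherian local ring, so its dimension is a natural number
  haveI : IsLocalRing (S ⧸ Ideal.span {g}) :=
    .of_surjective' (Ideal.Quotient.mk _) Ideal.Quotient.mk_surjective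
  obtain ⟨d, hd⟩ := Literature.AlgebraicGeometry.Resolution.ringKrullDim_eq_nat (S ⧸ Ideal.span {g})
  refine ⟨hnt, ?_, d, hd, ?_⟩
  · rw [Ideal.mk_ker, Ideal.ofList_singleton]
  · rw [← hdim, hd, List.length_singleton, Nat.cast_add, Nat.cast_one, add_comm]

end Summit.ResolutionOfSingularities.ResolutionOfSingularities.Theorems.FRationalResolution
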